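import Summits.QuantumFields.YangMills.Theorems.FlatTubeReductionDiagonalRatioOnCoreClosed
import Summits.QuantumFields.YangMills.Theorems.FlatTubeReductionRecordWindowSixth
import Summits.QuantumFields.YangMills.Theorems.LuscherReductionTwistedTraceScalingBTCoreWeight
import HarnessLib

/-!
# The β-NUMEROLOGY of the exact diagonal dressing: with `T = β^{1/8}`, `r_T = √(T/β)`, the FP window `βε² ≤ c_ε` and the slow window `orbitDist u < D·recordDelta1 L (1/6) β`,
# every smallness hypothesis of F8a holds eventually, and AM–GM turns the `orbitDist·β^{-1/2}` coefficient into `½orbitDist² + ½β^{-3/4}`: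
# `|f(u) − f(1)| ≤ (κ·orbitDist u² + C·β^{-3/4} + η)·f(1)` eventually, `κ, C` depending only on `(L, c_ε, Ξ₀)`
# (route `FlatTubeReduction`, crux K1 `NearFlatRatioLaw` stmt-QuantumFields-24720; seat `ym-line-ftr-p1` g14; rate twin «ratepack-v3 / frozen fibres»; R2b1 RECORD rung — no summit
# statement is proved here)

WHY (memo `Cruxes/NearFlatRatioLaw/Lines/ratepack-v3-frozen-g12.md` §6.1 (F8b)).  F8a′ `fpBOKernel_diag_two_sided_on_core'` gives, at one `β`, the sandwich
`(1 − (a₂+a_q)Ξ − η)f(1) ≤ f(u) ≤ (1 + (a₂+a_q)Ξ + e(a₁+a₂+a_q)²Ξ + η)f(1)` under six numeric smallness conditions.  Here: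
* §1 `diag_sqrt_sigma` and ★ `diag_coeff_bounds` — pure algebra: with `τ = orbitDist u ≤ 1`, `βε² ≤ c_ε`, `β⁻¹ ≤ (√β)⁻¹ ≤ 1`: `a₁ ≤ τA₁`, `a₂ ≤ τ²A₂`, `a_q ≤ τ(√β)⁻¹A_q`
  (`A₁, A₂, A_q` explicit in `L, c_ε`); ★ `diag_coeff_total` — with `τ(√β)⁻¹ ≤ ½(τ² + m)`: `(a₂+a_q)Ξ + e(a₁+a₂+a_q)²Ξ ≤ κτ² + Cm`, `κ = Ξ₀(A₂ + A_q/2 + e(A₁+A₂+A_q)²)`, `C = Ξ₀A_q/2`;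
* §2 `rpow_amgm_sqrt` (`τ(√β)⁻¹ ≤ ½(τ² + β^{-3/4})`, `β ≥ 1`), `inv_le_inv_sqrt`, ★ `diag_numerology_eventually` (the six smallness facts at `T = β^{1/8}` eventually in `β`),
  `rpow_neg_three_quarters_le_bareLambda_sq` (`β^{-3/4} ≤ L²·λ_b(L³β)²` for `β ≥ 1` — so the slack is `O(λ_b²)`);
* §3 ★★★ `fpBOKernel_diagRatio_eventually` — `∃ κ C ≥ 0, ∀ᶠ β, ∀ Ω ε u Ξ η …`: the two-sided bound and `|f(u)/f(1) − 1| ≤ κ·orbitDist u² + Cβ^{-3/4} + η` (when `f(1) > 0`), the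
  hypotheses being ONLY the profile data, `βε² ≤ c_ε`, `0 ≤ Ξ ≤ Ξ₀` with the moment bound, and the two tails `η` — the PROFILE INTERFACE.
HONEST FRAMING: real-analysis bookkeeping; femto rung R2b1 (RECORD label); not infinite volume, not a gap, not Clay.  No defs, no named facts, no `sorry`.
-/

set_option autoImplicit false

noncomputable section

open MeasureTheory Filter Topology Real Set
open scoped BigOperators
open Literature.MathematicalPhysics.QuantumFieldTheory
open Literature.MathematicalPhysics.QuantumLattice

namespace Summit.QuantumFields.YangMills.Theorems.FemtoTransferGap.RateTube

open Summit.QuantumFields.YangMills.Theorems.FemtoTransferGap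
open Summit.QuantumFields.YangMills.Theorems.FemtoTransferGap.TwoLattice
open Summit.QuantumFields.YangMills.Theorems.FemtoTransferGap.TwoLattice.ConstTube
open Summit.QuantumFields.YangMills.Theorems.FemtoTransferGap.TwoLattice.Avg
open Summit.QuantumFields.YangMills.Theorems.FemtoTransferGap.TwoLattice.Cov
open Summit.QuantumFields.YangMills.Theorems.FemtoTransferGap.TwoLattice.Toron
open Summit.QuantumFields.YangMills.Theorems.FemtoTransferGap.TwoLattice.Stiff (LinkSpace)
open Summit.QuantumFields.YangMills.Theorems.FemtoCutoffLadder

/-! ## §1 Pure algebra: the coefficients are `∝ τ`, `∝ τ²`, `∝ τ·(√β)⁻¹` -/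

section Algebra

/-- `√(ℓ³·(12τ⁴)) = √(12ℓ³)·τ²` (`ℓ, τ ≥ 0`). [folklore] -/
theorem diag_sqrt_sigma {ℓ : ℝ} (hℓ : 0 ≤ ℓ) (τ : ℝ) : Real.sqrt (ℓ ^ 3 * (12 * τ ^ 4)) = Real.sqrt (12 * ℓ ^ 3) * τ ^ 2 := by
  have e : ℓ ^ 3 * (12 * τ ^ 4) = (12 * ℓ ^ 3) * (τ ^ 2) ^ 2 := by ring
  rw [e, Real.sqrt_mul (by positivity), Real.sqrt_sq (by positivity)]

/-- ★ **The three coefficient bounds.**  With `0 ≤ τ ≤ 1`, `0 ≤ q ≤ c_ε` (`q = βε²`), `0 ≤ b ≤ s ≤ 1` (`s = (√β)⁻¹`, `b = β⁻¹`), `N_E, N₃, N_P, ℓ ≥ 0`: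
`a₁ ≤ τ·A₁`, `a₂ ≤ τ²·A₂`, `a_q ≤ τ·s·A_q`. [folklore] -/
theorem diag_coeff_bounds {τ q cε s b NE N3 NP ℓ : ℝ} (hτ0 : 0 ≤ τ) (hτ1 : τ ≤ 1) (hq : q ≤ cε) (hb0 : 0 ≤ b) (hbs : b ≤ s)
    (hNE : 0 ≤ NE) (hN3 : 0 ≤ N3) (hNP : 0 ≤ NP) (hℓ : 0 ≤ ℓ) :
    τ * (24 * (NE * (24302 * ℓ ^ 2 + 6 * q)) + 80 * N3) ≤ τ * (24 * (NE * (24302 * ℓ ^ 2 + 6 * cε)) + 80 * N3) ∧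
    τ ^ 2 * (48 * (NE * (24302 * ℓ ^ 2 + 6 * q)) + 72500000 * N3) + 25 * (ℓ ^ 3 * (12 * τ ^ 4)) * N3 + 3456 * NP * Real.sqrt (ℓ ^ 3 * (12 * τ ^ 4)) ≤
      τ ^ 2 * (48 * (NE * (24302 * ℓ ^ 2 + 6 * cε)) + 72500000 * N3 + 300 * ℓ ^ 3 * N3 + 3456 * NP * Real.sqrt (12 * ℓ ^ 3)) ∧
    4 * NP * ((ℓ ^ 3 * (12 * τ ^ 4)) * (14688 * s + 1401138 * b) + 700000 * τ * s) ≤ τ * s * (4 * NP * (12 * ℓ ^ 3 * 1415826 + 700000)) := by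
  have hs0 : 0 ≤ s := hb0.trans hbs
  have hτ2 : τ ^ 2 ≤ τ := by nlinarith
  have hτ4 : τ ^ 4 ≤ τ ^ 2 := by nlinarith
  have hℓ3 : 0 ≤ ℓ ^ 3 := by positivity
  refine ⟨?_, ?_, ?_⟩
  · refine mul_le_mul_of_nonneg_left ?_ hτ0
    nlinarith [mul_le_mul_of_nonneg_left hq hNE]
  · rw [diag_sqrt_sigma hℓ τ]
    have h1 : τ ^ 2 * (48 * (NE * (24302 * ℓ ^ 2 + 6 * q)) + 72500000 * N3) ≤ τ ^ 2 * (48 * (NE * (24302 * ℓ ^ 2 + 6 * cε)) + 72500000 * N3) := by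
      refine mul_le_mul_of_nonneg_left ?_ (by positivity)
      nlinarith [mul_le_mul_of_nonneg_left hq hNE]
    have h2 : 25 * (ℓ ^ 3 * (12 * τ ^ 4)) * N3 ≤ τ ^ 2 * (300 * ℓ ^ 3 * N3) := by
      have := mul_le_mul_of_nonneg_left hτ4 (by positivity : (0 : ℝ) ≤ 300 * ℓ ^ 3 * N3)
      nlinarith
    have h3 : 3456 * NP * (Real.sqrt (12 * ℓ ^ 3) * τ ^ 2) = τ ^ 2 * (3456 * NP * Real.sqrt (12 * ℓ ^ 3)) := by ring
    nlinarith [h1, h2, h3]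
  · have h1 : (ℓ ^ 3 * (12 * τ ^ 4)) * (14688 * s + 1401138 * b) ≤ τ * s * (12 * ℓ ^ 3 * 1415826) := by
      have hsb : 14688 * s + 1401138 * b ≤ 1415826 * s := by linarith
      have hτ4' : τ ^ 4 ≤ τ := hτ4.trans hτ2
      calc (ℓ ^ 3 * (12 * τ ^ 4)) * (14688 * s + 1401138 * b) ≤ (ℓ ^ 3 * (12 * τ ^ 4)) * (1415826 * s) :=
            mul_le_mul_of_nonneg_left hsb (by positivity)
        _ ≤ (ℓ ^ 3 * (12 * τ)) * (1415826 * s) := by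
            refine mul_le_mul_of_nonneg_right ?_ (by positivity)
            exact mul_le_mul_of_nonneg_left (by linarith) hℓ3
        _ = τ * s * (12 * ℓ ^ 3 * 1415826) := by ring
    have e : τ * s * (4 * NP * (12 * ℓ ^ 3 * 1415826 + 700000)) = 4 * NP * (τ * s * (12 * ℓ ^ 3 * 1415826) + 700000 * τ * s) := by ring
    rw [e]
    exact mul_le_mul_of_nonneg_left (by linarith) (by positivity)

/-- ★ **The total coefficient after AM–GM** (abstract form): from `a₁ ≤ τA₁`, `a₂ ≤ τ²A₂`, `a_q ≤ τsA_q` (all nonnegative, `τ, s ≤ 1`), `0 ≤ Ξ ≤ Ξ₀` and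
`τs ≤ ½(τ² + m)`, `m ≥ 0` (`s ≤ 1`):  `(a₂ + a_q)Ξ ≤ κτ² + Cm` and `(a₂ + a_q)Ξ + e(a₁ + a₂ + a_q)²Ξ ≤ κτ² + Cm` with `κ = Ξ₀(A₂ + A_q/2 + e(A₁+A₂+A_q)²)`, `C = Ξ₀A_q/2`.
[folklore] -/
theorem diag_coeff_total {a₁ a₂ aq A₁ A₂ Aq τ s m Ξ Ξ₀ : ℝ} (ha₁ : 0 ≤ a₁) (ha₂ : 0 ≤ a₂) (haq : 0 ≤ aq) (hA₂ : 0 ≤ A₂) (hAq : 0 ≤ Aq)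
    (hτ0 : 0 ≤ τ) (hτ1 : τ ≤ 1) (hs1 : s ≤ 1) (hm : 0 ≤ m) (hΞ0 : 0 ≤ Ξ) (hΞ : Ξ ≤ Ξ₀) (hamgm : τ * s ≤ (τ ^ 2 + m) / 2)
    (hb1 : a₁ ≤ τ * A₁) (hb2 : a₂ ≤ τ ^ 2 * A₂) (hb3 : aq ≤ τ * s * Aq) :
    (a₂ + aq) * Ξ ≤ Ξ₀ * (A₂ + Aq / 2 + Real.exp 1 * (A₁ + A₂ + Aq) ^ 2) * τ ^ 2 + Ξ₀ * Aq / 2 * m ∧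
    (a₂ + aq) * Ξ + Real.exp 1 * (a₁ + a₂ + aq) ^ 2 * Ξ ≤ Ξ₀ * (A₂ + Aq / 2 + Real.exp 1 * (A₁ + A₂ + Aq) ^ 2) * τ ^ 2 + Ξ₀ * Aq / 2 * m := by
  have hΞ₀ : 0 ≤ Ξ₀ := hΞ0.trans hΞ
  have hτ2 : τ ^ 2 ≤ τ := by nlinarith
  have hb2' : a₂ ≤ τ * A₂ := hb2.trans (mul_le_mul_of_nonneg_right hτ2 hA₂)
  have hb3' : aq ≤ τ * Aq := hb3.trans (by
    have : τ * s ≤ τ := by nlinarith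
    exact mul_le_mul_of_nonneg_right this hAq)
  -- the square
  have hsum : a₁ + a₂ + aq ≤ τ * (A₁ + A₂ + Aq) := by nlinarith
  have hsq : (a₁ + a₂ + aq) ^ 2 ≤ τ ^ 2 * (A₁ + A₂ + Aq) ^ 2 := by
    have h0 : 0 ≤ a₁ + a₂ + aq := by positivity
    have := pow_le_pow_left₀ h0 hsum 2
    rw [mul_pow] at this; exact this
  -- the first-order terms against `Ξ`
  have hf1 : a₂ * Ξ ≤ τ ^ 2 * A₂ * Ξ₀ := mul_le_mul hb2 hΞ hΞ0 (by positivity)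
  have hf2 : aq * Ξ ≤ (τ ^ 2 + m) / 2 * Aq * Ξ₀ := by
    have : aq ≤ (τ ^ 2 + m) / 2 * Aq := hb3.trans (mul_le_mul_of_nonneg_right hamgm hAq)
    exact mul_le_mul this hΞ hΞ0 (by positivity)
  have hf3 : Real.exp 1 * (a₁ + a₂ + aq) ^ 2 * Ξ ≤ Real.exp 1 * (τ ^ 2 * (A₁ + A₂ + Aq) ^ 2) * Ξ₀ :=
    mul_le_mul (mul_le_mul_of_nonneg_left hsq (Real.exp_pos 1).le) hΞ hΞ0 (by positivity)
  have hf30 : 0 ≤ Real.exp 1 * (a₁ + a₂ + aq) ^ 2 * Ξ := by positivity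
  have hextra : 0 ≤ Real.exp 1 * (τ ^ 2 * (A₁ + A₂ + Aq) ^ 2) * Ξ₀ := by positivity
  have e : Ξ₀ * (A₂ + Aq / 2 + Real.exp 1 * (A₁ + A₂ + Aq) ^ 2) * τ ^ 2 + Ξ₀ * Aq / 2 * m =
      τ ^ 2 * A₂ * Ξ₀ + (τ ^ 2 + m) / 2 * Aq * Ξ₀ + Real.exp 1 * (τ ^ 2 * (A₁ + A₂ + Aq) ^ 2) * Ξ₀ := by ring
  rw [e, add_mul]
  constructor
  · linarith
  · linarith

/-- The `hsum` smallness from the three coefficient bounds (abstract form): `τ ≤ δ`, `T ≥ 0`, and `δ(A₁+A₂)(1+3T) + sA_q(1+2T)² ≤ 1`. [folklore] -/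
theorem diag_hsum_of_bounds {a₁ a₂ aq A₁ A₂ Aq τ s δ T : ℝ} (hA₁ : 0 ≤ A₁) (hA₂ : 0 ≤ A₂) (hAq : 0 ≤ Aq) (hτ0 : 0 ≤ τ) (hτ1 : τ ≤ 1) (hτδ : τ ≤ δ) (hs0 : 0 ≤ s) (hT : 0 ≤ T)
    (hb1 : a₁ ≤ τ * A₁) (hb2 : a₂ ≤ τ ^ 2 * A₂) (hb3 : aq ≤ τ * s * Aq) (he : δ * (A₁ + A₂) * (1 + 3 * T) + s * Aq * (1 + 2 * T) ^ 2 ≤ 1) :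
    (a₁ + a₂) * (1 + 3 * T) + aq * (1 + 2 * T) ^ 2 ≤ 1 := by
  have hτ2 : τ ^ 2 ≤ τ := by nlinarith
  have h12 : a₁ + a₂ ≤ δ * (A₁ + A₂) := by
    have h2' : τ ^ 2 * A₂ ≤ τ * A₂ := mul_le_mul_of_nonneg_right hτ2 hA₂
    have h3' : τ * (A₁ + A₂) ≤ δ * (A₁ + A₂) := mul_le_mul_of_nonneg_right hτδ (by positivity)
    linarith
  have h3 : aq ≤ s * Aq := hb3.trans (by
    have : τ * s ≤ s := by nlinarith
    exact mul_le_mul_of_nonneg_right this hAq)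
  have i1 := mul_le_mul_of_nonneg_right h12 (by positivity : (0 : ℝ) ≤ 1 + 3 * T)
  have i2 := mul_le_mul_of_nonneg_right h3 (sq_nonneg (1 + 2 * T))
  linarith

/-- Weakening of a two-sided multiplicative sandwich to a symmetric one, and its ratio form. [folklore] -/
theorem diag_two_sided_weaken {P R X η f1 fu : ℝ} (hf10 : 0 ≤ f1) (hP : P ≤ X) (hPR : P + R ≤ X) (hlo : (1 - P - η) * f1 ≤ fu) (hhi : fu ≤ (1 + P + R + η) * f1) :
    (1 - (X + η)) * f1 ≤ fu ∧ fu ≤ (1 + (X + η)) * f1 ∧ (0 < f1 → |fu / f1 - 1| ≤ X + η) := by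
  have hlo' : (1 - (X + η)) * f1 ≤ fu := (mul_le_mul_of_nonneg_right (by linarith) hf10).trans hlo
  have hhi' : fu ≤ (1 + (X + η)) * f1 := hhi.trans (mul_le_mul_of_nonneg_right (by linarith) hf10)
  refine ⟨hlo', hhi', fun hf1p => ?_⟩
  rw [abs_le]
  constructor
  · rw [le_sub_iff_add_le, le_div_iff₀ hf1p]; linarith
  · rw [sub_le_iff_le_add, div_le_iff₀ hf1p]; linarith

end Algebra

/-! ## §2 The β-numerology -/

variable {L : ℕ} [NeZero L]

/-- AM–GM at the scales `β^{-1/8}`, `β^{-3/8}`: `τ·(√β)⁻¹ ≤ ½(τ² + β^{-3/4})` for `β ≥ 1`. [folklore] -/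
theorem rpow_amgm_sqrt {β : ℝ} (hβ : 1 ≤ β) (τ : ℝ) : τ * (Real.sqrt β)⁻¹ ≤ (τ ^ 2 + β ^ (-((3 : ℝ) / 4))) / 2 := by
  have hβ0 : 0 < β := by linarith
  set x : ℝ := τ * β ^ (-((1 : ℝ) / 8)) with hx
  set y : ℝ := β ^ (-((3 : ℝ) / 8)) with hy
  have hxy : x * y = τ * (Real.sqrt β)⁻¹ := by
    rw [hx, hy, mul_assoc, ← Real.rpow_add hβ0, Real.sqrt_eq_rpow, ← Real.rpow_neg hβ0.le]; norm_num
  have hx2 : x ^ 2 = τ ^ 2 * β ^ (-((1 : ℝ) / 4)) := by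
    rw [hx, mul_pow, ← Real.rpow_natCast (β ^ (-((1 : ℝ) / 8))) 2, ← Real.rpow_mul hβ0.le]; norm_num
  have hy2 : y ^ 2 = β ^ (-((3 : ℝ) / 4)) := by
    rw [hy, ← Real.rpow_natCast (β ^ (-((3 : ℝ) / 8))) 2, ← Real.rpow_mul hβ0.le]; norm_num
  have h14 : β ^ (-((1 : ℝ) / 4)) ≤ 1 := Real.rpow_le_one_of_one_le_of_nonpos hβ (by norm_num)
  have h := two_mul_le_add_sq x y
  rw [hx2, hy2, mul_assoc, hxy] at h
  nlinarith [mul_le_mul_of_nonneg_left h14 (sq_nonneg τ)]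

/-- `β⁻¹ ≤ (√β)⁻¹ ≤ 1` for `β ≥ 1`. [folklore] -/
theorem inv_le_inv_sqrt {β : ℝ} (hβ : 1 ≤ β) : 0 ≤ β⁻¹ ∧ β⁻¹ ≤ (Real.sqrt β)⁻¹ ∧ (Real.sqrt β)⁻¹ ≤ 1 := by
  have hβ0 : 0 < β := by linarith
  have hs1 : 1 ≤ Real.sqrt β := Real.one_le_sqrt.mpr hβ
  have hs0 : 0 < Real.sqrt β := by linarith
  have hsβ : Real.sqrt β ≤ β := by
    have h := Real.sqrt_le_sqrt (show β ≤ β ^ 2 by nlinarith)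
    rwa [Real.sqrt_sq hβ0.le] at h
  exact ⟨inv_nonneg.mpr hβ0.le, inv_anti₀ hs0 hsβ, inv_le_one_of_one_le₀ hs1⟩

/-- `√(β^{1/8}/β) = β^{-7/16}` (`β > 0`) — the fibre radius at level `T = β^{1/8}`. [folklore] -/
theorem sqrt_rpow_eighth_div {β : ℝ} (hβ : 0 < β) : Real.sqrt (β ^ ((1 : ℝ) / 8) / β) = β ^ (-((7 : ℝ) / 16)) := by
  have e : β ^ ((1 : ℝ) / 8) / β = β ^ (-((7 : ℝ) / 8)) := by
    rw [show (-((7 : ℝ) / 8)) = (1 : ℝ) / 8 - 1 by norm_num, Real.rpow_sub hβ, Real.rpow_one]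
  rw [e, Real.sqrt_eq_rpow, ← Real.rpow_mul hβ.le]; norm_num

/-- ★ **The six smallness facts, eventually in `β`** (`D, K₁, K₂ ≥ 0`): with `T = β^{1/8}`, `r_T = √(T/β)`, `δ₁ = D·recordDelta1 L (1/6) β`:
`β ≥ 1`, `r_T + r_T ≤ 1/30`, `3L(√(T/β) + 5√2r_T + √2r_T) < 1`, `δ₁ ≤ 1/40`, `L³·12δ₁⁴ < 2`, `δ₁K₁(1+3T) + (√β)⁻¹K₂(1+2T)² ≤ 1`. [folklore] -/
theorem diag_numerology_eventually {D K₁ K₂ : ℝ} (hD : 0 ≤ D) (hK₁ : 0 ≤ K₁) (hK₂ : 0 ≤ K₂) :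
    ∀ᶠ β : ℝ in atTop, 1 ≤ β ∧ Real.sqrt (β ^ ((1 : ℝ) / 8) / β) + Real.sqrt (β ^ ((1 : ℝ) / 8) / β) ≤ 1 / 30 ∧
      3 * L * (Real.sqrt (β ^ ((1 : ℝ) / 8) / β) + 5 * Real.sqrt 2 * Real.sqrt (β ^ ((1 : ℝ) / 8) / β) + Real.sqrt 2 * Real.sqrt (β ^ ((1 : ℝ) / 8) / β)) < 1 ∧
      D * recordDelta1 L (1 / 6) β ≤ 1 / 40 ∧ (L : ℝ) ^ 3 * (12 * (D * recordDelta1 L (1 / 6) β) ^ 4) < 2 ∧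
      D * recordDelta1 L (1 / 6) β * K₁ * (1 + 3 * β ^ ((1 : ℝ) / 8)) + (Real.sqrt β)⁻¹ * K₂ * (1 + 2 * β ^ ((1 : ℝ) / 8)) ^ 2 ≤ 1 := by
  have hN := card_site_pos (L := L)
  have hL0 : (0 : ℝ) ≤ L := Nat.cast_nonneg _
  -- `r_T → 0`
  have hrt : Tendsto (fun β : ℝ => Real.sqrt (β ^ ((1 : ℝ) / 8) / β)) atTop (𝓝 0) := by
    refine (tendsto_rpow_neg_atTop (show (0 : ℝ) < 7 / 16 by norm_num)).congr' ?_
    filter_upwards [Filter.eventually_gt_atTop (0 : ℝ)] with β hβ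
    rw [sqrt_rpow_eighth_div hβ]
  have h1 : ∀ᶠ β : ℝ in atTop, Real.sqrt (β ^ ((1 : ℝ) / 8) / β) + Real.sqrt (β ^ ((1 : ℝ) / 8) / β) ≤ 1 / 30 := by
    have h := hrt.add hrt
    rw [add_zero] at h
    exact h.eventually (eventually_le_nhds (by norm_num))
  have h2 : ∀ᶠ β : ℝ in atTop, 3 * L * (Real.sqrt (β ^ ((1 : ℝ) / 8) / β) + 5 * Real.sqrt 2 * Real.sqrt (β ^ ((1 : ℝ) / 8) / β) +
      Real.sqrt 2 * Real.sqrt (β ^ ((1 : ℝ) / 8) / β)) < 1 := by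
    have h := ((hrt.add (hrt.const_mul (5 * Real.sqrt 2))).add (hrt.const_mul (Real.sqrt 2))).const_mul (3 * (L : ℝ))
    simp only [mul_zero, add_zero] at h
    exact h.eventually (eventually_lt_nhds (by norm_num))
  -- `δ₁ → 0`
  have hδ : Tendsto (fun β : ℝ => D * recordDelta1 L (1 / 6) β) atTop (𝓝 0) := by
    have h := ((tendsto_powScale (σ := 1 / 6) (by norm_num)).const_mul 14).div_const (Fintype.card (Site 3 L) : ℝ) |>.const_mul D
    simp only [mul_zero, zero_div] at h
    refine h.congr' (Filter.Eventually.of_forall fun β => ?_)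
    unfold recordDelta1; ring
  have h3 : ∀ᶠ β : ℝ in atTop, D * recordDelta1 L (1 / 6) β ≤ 1 / 40 := hδ.eventually (eventually_le_nhds (by norm_num))
  have h4 : ∀ᶠ β : ℝ in atTop, (L : ℝ) ^ 3 * (12 * (D * recordDelta1 L (1 / 6) β) ^ 4) < 2 := by
    have h := ((hδ.pow 4).const_mul 12).const_mul ((L : ℝ) ^ 3)
    simp only [zero_pow (by norm_num : (4 : ℕ) ≠ 0), mul_zero] at h
    exact h.eventually (eventually_lt_nhds (by norm_num))
  -- the `hsum` budget: `δ₁(1+3T) ≤ 4c·β^{-1/24}`, `(√β)⁻¹(1+2T)² ≤ 9β^{-1/4}`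
  have h24 : Tendsto (fun β : ℝ => (4 * (D * 14 / Fintype.card (Site 3 L)) * K₁) * β ^ (-((1 : ℝ) / 24)) + (9 * K₂) * β ^ (-((1 : ℝ) / 4))) atTop (𝓝 0) := by
    have h := ((tendsto_rpow_neg_atTop (show (0 : ℝ) < 1 / 24 by norm_num)).const_mul (4 * (D * 14 / Fintype.card (Site 3 L)) * K₁)).add
      ((tendsto_rpow_neg_atTop (show (0 : ℝ) < 1 / 4 by norm_num)).const_mul (9 * K₂))
    simpa using h
  have h5 : ∀ᶠ β : ℝ in atTop, D * recordDelta1 L (1 / 6) β * K₁ * (1 + 3 * β ^ ((1 : ℝ) / 8)) + (Real.sqrt β)⁻¹ * K₂ * (1 + 2 * β ^ ((1 : ℝ) / 8)) ^ 2 ≤ 1 := by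
    filter_upwards [h24.eventually (eventually_le_nhds (show (0 : ℝ) < 1 by norm_num)), Filter.eventually_ge_atTop (1 : ℝ)] with β hβ hβ1
    have hβ0 : 0 < β := by linarith
    have hT1 : 1 ≤ β ^ ((1 : ℝ) / 8) := Real.one_le_rpow hβ1 (by norm_num)
    have hT0 : 0 ≤ β ^ ((1 : ℝ) / 8) := by linarith
    -- `δ₁ = c β^{-1/6}`
    have hδe : D * recordDelta1 L (1 / 6) β = (D * 14 / Fintype.card (Site 3 L)) * β ^ (-((1 : ℝ) / 6)) := by
      unfold recordDelta1; rw [powScale_eq hβ1]; field_simp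
    have hc0 : 0 ≤ D * 14 / Fintype.card (Site 3 L) := by positivity
    -- first term
    have hA : D * recordDelta1 L (1 / 6) β * K₁ * (1 + 3 * β ^ ((1 : ℝ) / 8)) ≤ (4 * (D * 14 / Fintype.card (Site 3 L)) * K₁) * β ^ (-((1 : ℝ) / 24)) := by
      rw [hδe]
      have h13 : 1 + 3 * β ^ ((1 : ℝ) / 8) ≤ 4 * β ^ ((1 : ℝ) / 8) := by linarith
      have hprod : β ^ (-((1 : ℝ) / 6)) * β ^ ((1 : ℝ) / 8) = β ^ (-((1 : ℝ) / 24)) := by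
        rw [← Real.rpow_add hβ0]; norm_num
      have hβ6 : 0 ≤ β ^ (-((1 : ℝ) / 6)) := (Real.rpow_pos_of_pos hβ0 _).le
      calc (D * 14 / Fintype.card (Site 3 L)) * β ^ (-((1 : ℝ) / 6)) * K₁ * (1 + 3 * β ^ ((1 : ℝ) / 8))
          ≤ (D * 14 / Fintype.card (Site 3 L)) * β ^ (-((1 : ℝ) / 6)) * K₁ * (4 * β ^ ((1 : ℝ) / 8)) :=
            mul_le_mul_of_nonneg_left h13 (by positivity)
        _ = (4 * (D * 14 / Fintype.card (Site 3 L)) * K₁) * (β ^ (-((1 : ℝ) / 6)) * β ^ ((1 : ℝ) / 8)) := by ring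
        _ = (4 * (D * 14 / Fintype.card (Site 3 L)) * K₁) * β ^ (-((1 : ℝ) / 24)) := by rw [hprod]
    -- second term
    have hB : (Real.sqrt β)⁻¹ * K₂ * (1 + 2 * β ^ ((1 : ℝ) / 8)) ^ 2 ≤ (9 * K₂) * β ^ (-((1 : ℝ) / 4)) := by
      have hsq : (1 + 2 * β ^ ((1 : ℝ) / 8)) ^ 2 ≤ 9 * (β ^ ((1 : ℝ) / 8)) ^ 2 := by nlinarith
      have hT2 : (β ^ ((1 : ℝ) / 8)) ^ 2 = β ^ ((1 : ℝ) / 4) := by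
        rw [← Real.rpow_natCast (β ^ ((1 : ℝ) / 8)) 2, ← Real.rpow_mul hβ0.le]; norm_num
      have hsr : (Real.sqrt β)⁻¹ = β ^ (-((1 : ℝ) / 2)) := by
        rw [Real.sqrt_eq_rpow, ← Real.rpow_neg hβ0.le]
      have hprod : β ^ (-((1 : ℝ) / 2)) * β ^ ((1 : ℝ) / 4) = β ^ (-((1 : ℝ) / 4)) := by
        rw [← Real.rpow_add hβ0]; norm_num
      have hs0 : 0 ≤ β ^ (-((1 : ℝ) / 2)) := (Real.rpow_pos_of_pos hβ0 _).le
      rw [hsr]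
      calc β ^ (-((1 : ℝ) / 2)) * K₂ * (1 + 2 * β ^ ((1 : ℝ) / 8)) ^ 2 ≤ β ^ (-((1 : ℝ) / 2)) * K₂ * (9 * (β ^ ((1 : ℝ) / 8)) ^ 2) :=
            mul_le_mul_of_nonneg_left hsq (by positivity)
        _ = (9 * K₂) * (β ^ (-((1 : ℝ) / 2)) * β ^ ((1 : ℝ) / 4)) := by rw [hT2]; ring
        _ = (9 * K₂) * β ^ (-((1 : ℝ) / 4)) := by rw [hprod]
    linarith [hA, hB, hβ]
  filter_upwards [Filter.eventually_ge_atTop (1 : ℝ), h1, h2, h3, h4, h5] with β hβ e1 e2 e3 e4 e5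
  exact ⟨hβ, e1, e2, e3, e4, e5⟩

/-- **The slack is `O(λ_b²)`**: `β^{-3/4} ≤ L²·λ_b(L³β)²` for `β ≥ 1` (`λ_b(L³β) = (2/β)^{1/3}/L ≥ β^{-1/3}/L` and `β^{-3/4} ≤ β^{-2/3}`). [folklore] -/
theorem rpow_neg_three_quarters_le_bareLambda_sq {β : ℝ} (hβ : 1 ≤ β) : β ^ (-((3 : ℝ) / 4)) ≤ (L : ℝ) ^ 2 * bareLambda ((L : ℝ) ^ 3 * β) ^ 2 := by
  have hβ0 : 0 < β := by linarith
  have hL0 : (0 : ℝ) < L := by exact_mod_cast Nat.pos_of_ne_zero (NeZero.ne L)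
  rw [bareLambda_cube_mul hβ0 L, div_pow, mul_div_cancel₀ _ (by positivity)]
  -- `bareLambda β = 2^{1/3} β^{-1/3} ≥ β^{-1/3}`
  rw [bareLambda_eq_rpow hβ0]
  have h2 : (1 : ℝ) ≤ (2 : ℝ) ^ ((1 : ℝ) / 3) := Real.one_le_rpow (by norm_num) (by norm_num)
  have hb0 : 0 ≤ β ^ (-(1 : ℝ) / 3) := (Real.rpow_pos_of_pos hβ0 _).le
  have hge : β ^ (-(1 : ℝ) / 3) ≤ (2 : ℝ) ^ ((1 : ℝ) / 3) * β ^ (-(1 : ℝ) / 3) := by nlinarith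
  have hsq : (β ^ (-(1 : ℝ) / 3)) ^ 2 = β ^ (-((2 : ℝ) / 3)) := by
    rw [← Real.rpow_natCast (β ^ (-(1 : ℝ) / 3)) 2, ← Real.rpow_mul hβ0.le]; norm_num
  have hmono : β ^ (-((3 : ℝ) / 4)) ≤ β ^ (-((2 : ℝ) / 3)) := Real.rpow_le_rpow_of_exponent_le hβ (by norm_num)
  calc β ^ (-((3 : ℝ) / 4)) ≤ β ^ (-((2 : ℝ) / 3)) := hmono
    _ = (β ^ (-(1 : ℝ) / 3)) ^ 2 := hsq.symm
    _ ≤ ((2 : ℝ) ^ ((1 : ℝ) / 3) * β ^ (-(1 : ℝ) / 3)) ^ 2 := pow_le_pow_left₀ hb0 hge 2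

/-! ## §3 ★★★ The exact diagonal dressing, eventually in `β`, modulo the profile interface -/

set_option maxHeartbeats 1600000 in
/-- ★★★ **THE EXACT DIAGONAL DRESSING, EVENTUALLY.**  Fix `L`, `D ≥ 0` (slow window `δ₁ = D·recordDelta1 L (1/6)`), `c_ε ≥ 0` (FP window budget `βε² ≤ c_ε`) and `Ξ₀ ≥ 0`.
There are `κ, C ≥ 0` (explicit in `L, c_ε, Ξ₀`) such that eventually in `β`, for EVERY profile `Ω` (measurable, `0 ≤ Ω ≤ CΩ`, colour-blind, cap-supported), every `ε` with
`βε² ≤ c_ε`, every slow datum `u` with `orbitDist u < δ₁ β`, every moment number `0 ≤ Ξ ≤ Ξ₀` with `∫_{S′}ρ₁Λ⁴ ≤ Ξ∫ρ₁` and every tail bound `η` on the core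
`S′ = {βkin ≤ β^{1/8}} ∩ {β‖v̂‖² ≤ β^{1/8}} ∩ {β‖v̂′‖² ≤ β^{1/8}} ∩ supp`:  `(1 − κ·orbitDist u² − Cβ^{-3/4} − η)f(1) ≤ f(u) ≤ (1 + κ·orbitDist u² + Cβ^{-3/4} + η)f(1)` and,
if `f(1) > 0`, `|f(u)/f(1) − 1| ≤ κ·orbitDist u² + Cβ^{-3/4} + η` (`f(u) = fpBOKernel β Ω (fpWeight ε) u u / K₁^{(L³β)}(u,u)`). [cite: Luscher1983, §3] -/
theorem fpBOKernel_diagRatio_eventually {D cε Ξ₀ : ℝ} (hD : 0 ≤ D) (hcε : 0 ≤ cε) (hΞ₀ : 0 ≤ Ξ₀) :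
    ∃ κ C : ℝ, 0 ≤ κ ∧ 0 ≤ C ∧ ∀ᶠ β : ℝ in atTop, ∀ {Ω : LinkSpace L → ℝ}, Measurable Ω → ∀ {CΩ : ℝ}, (∀ x, |Ω x| ≤ CΩ) → (∀ x, 0 ≤ Ω x) →
      (∀ (g : SU2) (x : LinkSpace L), Ω (adL L g x) = Ω x) → (∀ v : Edge 3 L → Fin 3 → ℝ, Ω (linkEmbed L v) ≠ 0 → v ∈ capBalancedSet L) →
      ∀ (ε : ℝ), β * ε ^ 2 ≤ cε → ∀ (u : GaugeConfig 3 1 SU2), orbitDist u < D * recordDelta1 L (1 / 6) β → ∀ {Ξ η : ℝ}, 0 ≤ Ξ → Ξ ≤ Ξ₀ →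
      (∫ p in ({p : (Edge 3 L → Fin 3 → ℝ) × ((Edge 3 L → Fin 3 → ℝ) × (Site 3 L → SU2)) | β * kinDefect L (orthoTube L 1 p.1) (orthoTube L 1 p.2.1) p.2.2 ≤ β ^ ((1 : ℝ) / 8)} ∩
          {p | β * ‖linkEmbed L p.1‖ ^ 2 ≤ β ^ ((1 : ℝ) / 8)} ∩ {p | β * ‖linkEmbed L p.2.1‖ ^ 2 ≤ β ^ ((1 : ℝ) / 8)} ∩
          {p | Ω (linkEmbed L p.1) ≠ 0 ∧ Ω (linkEmbed L p.2.1) ≠ 0 ∧ fpWeight L ε p.2.2 ≠ 0}),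
        fpTriple L β Ω (fpWeight L ε) 1 1 p * (1 + β * kinDefect L (orthoTube L 1 p.1) (orthoTube L 1 p.2.1) p.2.2 + β * ‖linkEmbed L p.1‖ ^ 2 + β * ‖linkEmbed L p.2.1‖ ^ 2) ^ 4
        ∂((orthoTransverse L).prod ((orthoTransverse L).prod (gaugeMeasure L))) ≤
      Ξ * ∫ p, fpTriple L β Ω (fpWeight L ε) 1 1 p ∂((orthoTransverse L).prod ((orthoTransverse L).prod (gaugeMeasure L)))) →
      (∫ p in ({p : (Edge 3 L → Fin 3 → ℝ) × ((Edge 3 L → Fin 3 → ℝ) × (Site 3 L → SU2)) | β * kinDefect L (orthoTube L 1 p.1) (orthoTube L 1 p.2.1) p.2.2 ≤ β ^ ((1 : ℝ) / 8)} ∩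
          {p | β * ‖linkEmbed L p.1‖ ^ 2 ≤ β ^ ((1 : ℝ) / 8)} ∩ {p | β * ‖linkEmbed L p.2.1‖ ^ 2 ≤ β ^ ((1 : ℝ) / 8)} ∩
          {p | Ω (linkEmbed L p.1) ≠ 0 ∧ Ω (linkEmbed L p.2.1) ≠ 0 ∧ fpWeight L ε p.2.2 ≠ 0})ᶜ,
        fpTriple L β Ω (fpWeight L ε) 1 1 p ∂((orthoTransverse L).prod ((orthoTransverse L).prod (gaugeMeasure L))) ≤
      η * ∫ p, fpTriple L β Ω (fpWeight L ε) 1 1 p ∂((orthoTransverse L).prod ((orthoTransverse L).prod (gaugeMeasure L)))) →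
      (∀ d : SU2, (∫ p in ({p : (Edge 3 L → Fin 3 → ℝ) × ((Edge 3 L → Fin 3 → ℝ) × (Site 3 L → SU2)) | β * kinDefect L (orthoTube L 1 p.1) (orthoTube L 1 p.2.1) p.2.2 ≤ β ^ ((1 : ℝ) / 8)} ∩
          {p | β * ‖linkEmbed L p.1‖ ^ 2 ≤ β ^ ((1 : ℝ) / 8)} ∩ {p | β * ‖linkEmbed L p.2.1‖ ^ 2 ≤ β ^ ((1 : ℝ) / 8)} ∩
          {p | Ω (linkEmbed L p.1) ≠ 0 ∧ Ω (linkEmbed L p.2.1) ≠ 0 ∧ fpWeight L ε p.2.2 ≠ 0})ᶜ,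
        fpTriple L β Ω (fpWeight L ε) (gaugeTransform (fun _ : Site 3 1 => d) u) (gaugeTransform (fun _ : Site 3 1 => d) u) p
        ∂((orthoTransverse L).prod ((orthoTransverse L).prod (gaugeMeasure L)))) / transferKernel su2Rep ((L : ℝ) ^ 3 * β) u u ≤
      η * ((∫ p, fpTriple L β Ω (fpWeight L ε) 1 1 p ∂((orthoTransverse L).prod ((orthoTransverse L).prod (gaugeMeasure L)))) /
        transferKernel su2Rep ((L : ℝ) ^ 3 * β) (1 : GaugeConfig 3 1 SU2) 1)) →
      (1 - (κ * orbitDist u ^ 2 + C * β ^ (-((3 : ℝ) / 4)) + η)) * (fpBOKernel L β Ω (fpWeight L ε) 1 1 / transferKernel su2Rep ((L : ℝ) ^ 3 * β) (1 : GaugeConfig 3 1 SU2) 1) ≤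
          fpBOKernel L β Ω (fpWeight L ε) u u / transferKernel su2Rep ((L : ℝ) ^ 3 * β) u u ∧
        fpBOKernel L β Ω (fpWeight L ε) u u / transferKernel su2Rep ((L : ℝ) ^ 3 * β) u u ≤
          (1 + (κ * orbitDist u ^ 2 + C * β ^ (-((3 : ℝ) / 4)) + η)) * (fpBOKernel L β Ω (fpWeight L ε) 1 1 / transferKernel su2Rep ((L : ℝ) ^ 3 * β) (1 : GaugeConfig 3 1 SU2) 1) ∧
        (0 < fpBOKernel L β Ω (fpWeight L ε) 1 1 / transferKernel su2Rep ((L : ℝ) ^ 3 * β) (1 : GaugeConfig 3 1 SU2) 1 →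
          |fpBOKernel L β Ω (fpWeight L ε) u u / transferKernel su2Rep ((L : ℝ) ^ 3 * β) u u /
              (fpBOKernel L β Ω (fpWeight L ε) 1 1 / transferKernel su2Rep ((L : ℝ) ^ 3 * β) (1 : GaugeConfig 3 1 SU2) 1) - 1| ≤
            κ * orbitDist u ^ 2 + C * β ^ (-((3 : ℝ) / 4)) + η) := by
  -- the constants `A₁, A₂, A_q` (explicit in `L, c_ε`)
  have hNE0 : 0 ≤ (Fintype.card (Edge 3 L) : ℝ) := Nat.cast_nonneg _
  have hN30 : 0 ≤ (Fintype.card (Plaquette 3 L × Fin 3) : ℝ) := Nat.cast_nonneg _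
  have hNP0 : 0 ≤ (Fintype.card (Plaquette 3 L) : ℝ) := Nat.cast_nonneg _
  have hL0 : (0 : ℝ) ≤ L := Nat.cast_nonneg _
  have hA₁0 : 0 ≤ 24 * ((Fintype.card (Edge 3 L) : ℝ) * (24302 * (L : ℝ) ^ 2 + 6 * cε)) + 80 * (Fintype.card (Plaquette 3 L × Fin 3) : ℝ) := by positivity
  have hA₂0 : 0 ≤ 48 * ((Fintype.card (Edge 3 L) : ℝ) * (24302 * (L : ℝ) ^ 2 + 6 * cε)) + 72500000 * (Fintype.card (Plaquette 3 L × Fin 3) : ℝ) +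
      300 * (L : ℝ) ^ 3 * (Fintype.card (Plaquette 3 L × Fin 3) : ℝ) + 3456 * (Fintype.card (Plaquette 3 L) : ℝ) * Real.sqrt (12 * (L : ℝ) ^ 3) := by
    have := Real.sqrt_nonneg (12 * (L : ℝ) ^ 3); positivity
  have hAq0 : 0 ≤ 4 * (Fintype.card (Plaquette 3 L) : ℝ) * (12 * (L : ℝ) ^ 3 * 1415826 + 700000) := by positivity
  refine ⟨Ξ₀ * ((48 * ((Fintype.card (Edge 3 L) : ℝ) * (24302 * (L : ℝ) ^ 2 + 6 * cε)) + 72500000 * (Fintype.card (Plaquette 3 L × Fin 3) : ℝ) +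
      300 * (L : ℝ) ^ 3 * (Fintype.card (Plaquette 3 L × Fin 3) : ℝ) + 3456 * (Fintype.card (Plaquette 3 L) : ℝ) * Real.sqrt (12 * (L : ℝ) ^ 3)) +
      4 * (Fintype.card (Plaquette 3 L) : ℝ) * (12 * (L : ℝ) ^ 3 * 1415826 + 700000) / 2 +
      Real.exp 1 * ((24 * ((Fintype.card (Edge 3 L) : ℝ) * (24302 * (L : ℝ) ^ 2 + 6 * cε)) + 80 * (Fintype.card (Plaquette 3 L × Fin 3) : ℝ)) +
        (48 * ((Fintype.card (Edge 3 L) : ℝ) * (24302 * (L : ℝ) ^ 2 + 6 * cε)) + 72500000 * (Fintype.card (Plaquette 3 L × Fin 3) : ℝ) +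
          300 * (L : ℝ) ^ 3 * (Fintype.card (Plaquette 3 L × Fin 3) : ℝ) + 3456 * (Fintype.card (Plaquette 3 L) : ℝ) * Real.sqrt (12 * (L : ℝ) ^ 3)) +
        4 * (Fintype.card (Plaquette 3 L) : ℝ) * (12 * (L : ℝ) ^ 3 * 1415826 + 700000)) ^ 2),
    Ξ₀ * (4 * (Fintype.card (Plaquette 3 L) : ℝ) * (12 * (L : ℝ) ^ 3 * 1415826 + 700000)) / 2, by positivity, by positivity, ?_⟩
  filter_upwards [diag_numerology_eventually (L := L) hD (add_nonneg hA₁0 hA₂0) hAq0] with β hnum Ω hΩm CΩ hCΩ hΩ0 hΩinv hΩc ε hε u hu Ξ η hΞ0 hΞ1 hΞ htail1 htailu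
  obtain ⟨hβ1, e1, e2, e3, e4, e5⟩ := hnum
  have hβ0 : 0 < β := by linarith
  -- the slow datum in the window
  have hτ0 : 0 ≤ orbitDist u := orbitDist_nonneg u
  have hτδ : orbitDist u ≤ D * recordDelta1 L (1 / 6) β := hu.le
  have hτ40 : orbitDist u ≤ 1 / 40 := hτδ.trans e3
  have hτ1 : orbitDist u ≤ 1 := by linarith
  have hσ2 : (L : ℝ) ^ 3 * (12 * orbitDist u ^ 4) < 2 :=
    lt_of_le_of_lt (mul_le_mul_of_nonneg_left (mul_le_mul_of_nonneg_left (pow_le_pow_left₀ hτ0 hτδ 4) (by norm_num)) (by positivity)) e4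
  -- the level and fibre radius
  have hT0 : 0 ≤ β ^ ((1 : ℝ) / 8) := (Real.rpow_pos_of_pos hβ0 _).le
  have hrT : ∀ r : ℝ, 0 ≤ r → β * r ^ 2 ≤ β ^ ((1 : ℝ) / 8) → r ≤ Real.sqrt (β ^ ((1 : ℝ) / 8) / β) := fun r hr h => by
    have h' : r ^ 2 ≤ β ^ ((1 : ℝ) / 8) / β := by rw [le_div_iff₀ hβ0]; linarith
    calc r = Real.sqrt (r ^ 2) := (Real.sqrt_sq hr).symm
      _ ≤ Real.sqrt (β ^ ((1 : ℝ) / 8) / β) := Real.sqrt_le_sqrt h'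
  -- the inverse powers and the FP budget
  obtain ⟨hb0, hbs, hs1⟩ := inv_le_inv_sqrt hβ1
  have hs0 : 0 ≤ (Real.sqrt β)⁻¹ := hb0.trans hbs
  have hq0 : 0 ≤ β * ε ^ 2 := by positivity
  -- the three coefficient bounds, `hsum`, nonnegativity of the coefficients
  obtain ⟨hc1, hc2, hc3⟩ := diag_coeff_bounds (NE := (Fintype.card (Edge 3 L) : ℝ)) (N3 := (Fintype.card (Plaquette 3 L × Fin 3) : ℝ))
    (NP := (Fintype.card (Plaquette 3 L) : ℝ)) (ℓ := (L : ℝ)) (q := β * ε ^ 2) (s := (Real.sqrt β)⁻¹) (b := β⁻¹) hτ0 hτ1 hε hb0 hbs hNE0 hN30 hNP0 hL0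
  have hsum := diag_hsum_of_bounds hA₁0 hA₂0 hAq0 hτ0 hτ1 hτδ hs0 hT0 hc1 hc2 hc3 e5
  have ha₁0 : 0 ≤ orbitDist u * (24 * ((Fintype.card (Edge 3 L) : ℝ) * (24302 * (L : ℝ) ^ 2 + 6 * (β * ε ^ 2))) + 80 * (Fintype.card (Plaquette 3 L × Fin 3) : ℝ)) := by
    positivity
  have ha₂0 : 0 ≤ orbitDist u ^ 2 * (48 * ((Fintype.card (Edge 3 L) : ℝ) * (24302 * (L : ℝ) ^ 2 + 6 * (β * ε ^ 2))) + 72500000 * (Fintype.card (Plaquette 3 L × Fin 3) : ℝ)) +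
      25 * ((L : ℝ) ^ 3 * (12 * orbitDist u ^ 4)) * (Fintype.card (Plaquette 3 L × Fin 3) : ℝ) +
      3456 * (Fintype.card (Plaquette 3 L) : ℝ) * Real.sqrt ((L : ℝ) ^ 3 * (12 * orbitDist u ^ 4)) := by
    have := Real.sqrt_nonneg ((L : ℝ) ^ 3 * (12 * orbitDist u ^ 4)); positivity
  have haq0 : 0 ≤ 4 * (Fintype.card (Plaquette 3 L) : ℝ) * (((L : ℝ) ^ 3 * (12 * orbitDist u ^ 4)) * (14688 * (Real.sqrt β)⁻¹ + 1401138 * β⁻¹) +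
      700000 * orbitDist u * (Real.sqrt β)⁻¹) := by positivity
  -- F8a′ and the total coefficient
  obtain ⟨hlo, hhi⟩ := fpBOKernel_diag_two_sided_on_core' (L := L) hβ1 hΩm hCΩ hΩ0 hΩinv hΩc ε u hτ40 hσ2 hrT e1 e2 hsum hΞ htail1 (fun d => htailu d)
  obtain ⟨ht1, ht2⟩ := diag_coeff_total ha₁0 ha₂0 haq0 hA₂0 hAq0 hτ0 hτ1 hs1 (Real.rpow_pos_of_pos hβ0 (-((3 : ℝ) / 4))).le hΞ0 hΞ1
    (rpow_amgm_sqrt hβ1 (orbitDist u)) hc1 hc2 hc3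
  have hf10 : 0 ≤ fpBOKernel L β Ω (fpWeight L ε) 1 1 / transferKernel su2Rep ((L : ℝ) ^ 3 * β) (1 : GaugeConfig 3 1 SU2) 1 :=
    div_nonneg (fpBOKernel_nonneg β hΩm hCΩ hΩ0 (measurable_fpWeight L ε) (abs_fpWeight_le L ε) (fun g => (fpWeight_mem_Icc L ε g).1) 1 1)
      (transferKernel_pos _ _ _ _).le
  exact diag_two_sided_weaken hf10 ht1 ht2 hlo hhi

end Summit.QuantumFields.YangMills.Theorems.FemtoTransferGap.RateTube

end
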